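import Summits.Ventures.HSemireg.SecantParityObjectLevelSignedLaw
import Summits.Ventures.HSemireg.SecantParityObjectLevelEFour
import HarnessLib

/-!
# Venture HSemireg — KERNEL INSTANTIATION of file IV's odd branch at `n = 4` with file IVb's `E⁴` data (s4-ref g16 P-1):
# «the hypothesis set of `even_and_four_dvd_of_chi_identity_of_odd_hermIndex` is inhabited at `n = 4`» as a TREE THEOREM,
# not a docstring — TRACK S4-PUSH (ii), seat `s4-prove-1` (g9); file VI of the lane's object-level series; file of record
# `s4push/prove-1/ATTEMPT-10.md` §0

HONEST FRAMING. Lean index of the computation cell `pub-hsemireg`; object level in the sense of files III/IV (the complex torus of the tree's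
Literature layer `Literature/Geometry/Kaehler/ComplexTorus*`; here `X = E_τ⁴ = (E_τ × E_τ) × (E_τ × E_τ)`, `η₄ = (E_τ ⊞ E_τ) ⊞ (E_τ ⊞ (−E_τ))`).
No sheaf, secant plane, Ext group or semiregularity map is constructed; th-7 §D's χ-identity enters BY VALUE (file IV's `hHRR`); nothing here says
that HC, HC_CM or HC_AV holds; nothing here is a new case of anything; (S3)'s signed words do not move.  NO definition, NO named fact: theorems
only, all PROVED (0 sorry).  This leaf imports files IV and IVb (both landed 2026-08-23: p370927 / p371348) and does nothing but feed IVb's seven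
theorems into IV's two general statements — the referee's binder-by-binder substitution (VERDICT-LANE2-PROVE1-FILEIVb-EFOUR-… ac7a521df717fcf4 §1 (b):
`hη ← isNSForm_eFour`, `hnd ← nondegenerate_eFour`, `e : Fin (2·(2·2)) ≃ _`, `hd hw hG ← 1, 1, 16 > 0`, `hHRR ← chi_identity_eFour`, `hs ← hermIndex_eFour = 1`)
checked by the kernel:
* `odd_two_add_hermIndex_eFour` — IV's `odd_add_hermIndex_of_chi_identity` at `m = 2` on `η₄`: `Odd (2 + hermIndex η₄)` (indeed `2 + 1`);
* **`even_and_four_dvd_eFour`** — IV's odd branch `even_and_four_dvd_of_chi_identity_of_odd_hermIndex` at `m = 2` on `η₄`: `Even 2 ∧ 4 ∣ 2·2` — the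
  conclusion is trivially true; the CONTENT is that all eight hypotheses are simultaneously discharged by tree theorems («no obstruction at `n = 4` for
  odd index», sheet S3INP-4 / S3INP-9, now kernel-checked rather than asserted in IVb's docstring).
The all-dimension version (every `n = 2m`, every index `s` with `m + s` odd, on `E_τ^{2m}`) is file V-b `SecantParityObjectLevelDiagonalClasses.lean`
(`chi_identity_signDiag`); its instantiation into IV's theorems follows the same two lines once V-b's hub olean is current.

Statements: s4-ref g16 (P-1, the `example` in its folder `chk/lean/EFourInstance.lean`); named and filed by s4-prove-1 g9 (2026-08-23); seat ×1 + kernel.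

## References

* [Lange2023AbelianVarietiesComplex] H. Lange, Abelian Varieties over the Complex Numbers (2023), §1.7.2 Lemma 1.7.5 and proof of Thm. 1.7.3,
  §2.4.4 Cor. 2.4.24 — as cited in files IV/IVb.
* Cell records: VERDICT-LANE2-PROVE1-FILEIVb-EFOUR-PROVE3-TORSORLOC-BRIDGE1-TSIGMA-PREFILING-2026-08-23.md §1 (b) P-1; STATEMENTS-S3INPUT.md rows S3INP-8, S3INP-9;
  ATTEMPT-9.md §1 (E); ATTEMPT-10.md §0.
-/

noncomputable section

open scoped ComplexOrder
open Complex Module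
open Literature.Geometry.Kaehler Literature.Geometry.Kaehler.ComplexTorus

namespace Summit.Ventures.HSemireg

namespace SecantParity

variable {τ : ℂ} (hτ : 0 < τ.im)

/-- **IV's signed law at `n = 4` on `η₄`**: `Odd (2 + hermIndex η₄)` from the χ-identity by value with `m = 2`, `d = w = 1`, `G = 16` (IVb
`chi_identity_eFour`). [cite: Lange2023AbelianVarietiesComplex, §1.7.2 Lemma 1.7.5 and proof of Thm. 1.7.3] -/
theorem odd_two_add_hermIndex_eFour (e : Fin (2 * (2 * 2)) ≃ (Fin 2 ⊕ Fin 2) ⊕ (Fin 2 ⊕ Fin 2)) :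
    Odd (2 + hermIndex (prodForm (prodForm (ellipticForm hτ.ne') (ellipticForm hτ.ne'))
      (prodForm (ellipticForm hτ.ne') (-ellipticForm hτ.ne')))) :=
  odd_add_hermIndex_of_chi_identity _ (isNSForm_eFour hτ) (nondegenerate_eFour hτ) e one_pos one_pos (by norm_num)
    (chi_identity_eFour hτ e)

include hτ in
/-- **s4-ref g16 P-1 — IV's ODD BRANCH INSTANTIATED AT `n = 4` (kernel):** all hypotheses of
`even_and_four_dvd_of_chi_identity_of_odd_hermIndex` (`η₄ ∈ NS(E⁴)`, non-degenerate, `m = 2`, `d = w = 1 > 0`, `G = 16 > 0`, the χ-identity by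
value, `hermIndex η₄ = 1` odd) are discharged by file IVb's theorems; conclusion `Even 2 ∧ 4 ∣ 2·2`.
[cite: Lange2023AbelianVarietiesComplex, §1.7.2 Lemma 1.7.5 and proof of Thm. 1.7.3] -/
theorem even_and_four_dvd_eFour (e : Fin (2 * (2 * 2)) ≃ (Fin 2 ⊕ Fin 2) ⊕ (Fin 2 ⊕ Fin 2)) :
    Even 2 ∧ 4 ∣ 2 * 2 :=
  even_and_four_dvd_of_chi_identity_of_odd_hermIndex _ (isNSForm_eFour hτ) (nondegenerate_eFour hτ) e
    one_pos one_pos (by norm_num) (chi_identity_eFour hτ e) (by rw [hermIndex_eFour hτ]; exact odd_one)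

end SecantParity

end Summit.Ventures.HSemireg
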